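import Mathlib
import Summits.NavierStokesRegularity.NavierStokesRegularity.Theorems.OrthantWakeOrthantTableStructure
import HarnessLib

/-!
# Realisation of EVERY non-negative feed/pump network as a KP network proper of `E₂(R)`
# (helper file for the crux `SubOnsagerCeiling.ForwardTailCeilingKP`, stmt-NavierStokesRegularity-27057, `--supports`)

The registered stubs `stub_primaryGradedLargeRatio` / `stub_primaryGradedSmallRatio` of the LEAD skeleton
`Cruxes/ForwardTailCeilingKP/Lines/kp_shell_barrier.lean` quantify over every table `α ∈ E₂(R)` (symmetric (4.2), cancelling
(4.3), `R`-comparable) that is ORTHANT (Kamke) and has DIAGONAL feeds.  The landed normal form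
(`Theorems.kpProper_quadTerm`, `Theorems.starved_coeff`) says that such a table WITHOUT differential in-shell triads is
determined by two non-negative matrices: the forward FEED matrix `W a e = α a a e (0,0,1)` (`x²_{a,n} → x_{e,n+1}`) and the
in-shell PUMP matrix `P a d = α a a d (0,0,0)` (`x²_{a,n} → x_{d,n}`, zero diagonal).  This file proves the CONVERSE,
def-free: EVERY pair of matrices `W ≥ 0`, `P ≥ 0` (zero diagonal) with entries in `{0} ∪ [2/R, 1]` is realised by a table of
`E₂(R)` that is orthant, has diagonal feeds, feed matrix `W`, pump matrix `P` and no differential triads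
(`kpNet_realization`).  So the triad-free part of both stubs is EXACTLY the family of non-negative feed/pump networks on four
modes — every architecture found by a numerical search over `(W, P)` (chains, re-entry pairs, side loops, pump ladders,
multi-reach loops, pockets, sprays) inhabits the stubs' hypotheses with no further check; together with the two grading
lemmas below (`kpNet_selfFeed_primary`: a mode with a self-feed is primary in EVERY structural grading;
`kpNet_twoCycle_primary`: both modes of a feed 2-cycle are primary in every structural grading) the stub asserts, BY NAME,
the ν-uniform super-critical shell barrier for those modes of every such network (`kpNet_barrier_of_primaryGraded`).

MOTIVATION (this hand's numerics, pure python, windowed Dormand–Prince integration of the inviscid front, reproducing the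
chain's front exponent `θ_f(1.1) = 0.6035` of hands leafhand-4-g0/g2 to four digits): the per-shell peak exponent `θ_f` of
the self-similar front DEcreases with the REACH of the network — chain `0.6035` (b ≈ 1.10), two-mode side loop `0.5825`
(b ≈ 1.115, = hand 4-g2's `y* ≈ 0.767`), three-mode multi-reach loops `≤ 0.574` (b ≈ 1.12) — against the kill line `θ = 1/2`
of the crux; all of these are `(W, P)` networks, hence tables of the class by this file.

HONEST FRAMING: algebra about Tao-type MODEL lattice tables (route SubOnsagerCeiling, rung TL-M2Break); no stub, crux or summit
is proved here and nothing in this file bears on Navier–Stokes regularity.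
[cite: Tao2016AveragedNS, §4 (4.2)–(4.3), §6.1] [cite: BarbatoMorandinRomito2011, §1 (1.1) (the Katz–Pavlović pair)]
-/

noncomputable section

-- the sub-problem namespace `NavierStokesRegularity.NavierStokesRegularity` is the tree's layout (D-0017)
set_option linter.dupNamespace false

namespace Summit.NavierStokesRegularity.NavierStokesRegularity.Theorems

open Finset
open Literature.Analysis.FluidPDE.TaoCascade

section KPNetW

variable {α : Fin 4 → Fin 4 → Fin 4 → ℤ × ℤ × ℤ → ℝ} {W P : Fin 4 → Fin 4 → ℝ}

/-- Symmetry (4.2) of the feed/pump table given in closed form on the four shifts. [this file] -/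
theorem kpNetW_symmetric
    (hfeed : ∀ i₁ i₂ i₃ : Fin 4, α i₁ i₂ i₃ ((0 : ℤ), (0 : ℤ), (1 : ℤ)) = if i₁ = i₂ then W i₁ i₃ else 0)
    (hup1 : ∀ i₁ i₂ i₃ : Fin 4, α i₁ i₂ i₃ ((1 : ℤ), (0 : ℤ), (0 : ℤ)) = if i₂ = i₃ then -(W i₂ i₁) / 2 else 0)
    (hup2 : ∀ i₁ i₂ i₃ : Fin 4, α i₁ i₂ i₃ ((0 : ℤ), (1 : ℤ), (0 : ℤ)) = if i₁ = i₃ then -(W i₁ i₂) / 2 else 0)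
    (hin : ∀ i₁ i₂ i₃ : Fin 4, α i₁ i₂ i₃ ((0 : ℤ), (0 : ℤ), (0 : ℤ)) =
      (if i₁ = i₂ then P i₁ i₃ else 0) + (if i₁ = i₃ then -(P i₁ i₂) / 2 else 0) +
        (if i₂ = i₃ then -(P i₂ i₁) / 2 else 0)) :
    IsSymmetricCoeff α := by
  intro i₁ i₂ i₃ μ₁ μ₂ μ₃ hμ
  rw [mem_shiftSet_iff] at hμ
  simp only [Prod.mk.injEq] at hμ
  rcases hμ with ⟨rfl, rfl, rfl⟩ | ⟨rfl, rfl, rfl⟩ | ⟨rfl, rfl, rfl⟩ | ⟨rfl, rfl, rfl⟩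
  · simp only [hin]
    fin_cases i₁ <;> fin_cases i₂ <;> fin_cases i₃ <;> simp
  · simp only [hup1, hup2]
  · simp only [hup1, hup2]
  · simp only [hfeed]
    fin_cases i₁ <;> fin_cases i₂ <;> fin_cases i₃ <;> simp

/-- Cancellation (4.3) of the feed/pump table. [this file] -/
theorem kpNetW_cancelling
    (hfeed : ∀ i₁ i₂ i₃ : Fin 4, α i₁ i₂ i₃ ((0 : ℤ), (0 : ℤ), (1 : ℤ)) = if i₁ = i₂ then W i₁ i₃ else 0)
    (hup1 : ∀ i₁ i₂ i₃ : Fin 4, α i₁ i₂ i₃ ((1 : ℤ), (0 : ℤ), (0 : ℤ)) = if i₂ = i₃ then -(W i₂ i₁) / 2 else 0)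
    (hup2 : ∀ i₁ i₂ i₃ : Fin 4, α i₁ i₂ i₃ ((0 : ℤ), (1 : ℤ), (0 : ℤ)) = if i₁ = i₃ then -(W i₁ i₂) / 2 else 0)
    (hin : ∀ i₁ i₂ i₃ : Fin 4, α i₁ i₂ i₃ ((0 : ℤ), (0 : ℤ), (0 : ℤ)) =
      (if i₁ = i₂ then P i₁ i₃ else 0) + (if i₁ = i₃ then -(P i₁ i₂) / 2 else 0) +
        (if i₂ = i₃ then -(P i₂ i₁) / 2 else 0)) :
    IsCancellingCoeff α := by
  intro i₁ i₂ i₃ μ₁ μ₂ μ₃ hμ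
  rw [mem_shiftSet_iff] at hμ
  simp only [Prod.mk.injEq] at hμ
  rcases hμ with ⟨rfl, rfl, rfl⟩ | ⟨rfl, rfl, rfl⟩ | ⟨rfl, rfl, rfl⟩ | ⟨rfl, rfl, rfl⟩ <;>
    simp only [hin, hfeed, hup1, hup2] <;>
    fin_cases i₁ <;> fin_cases i₂ <;> fin_cases i₃ <;> simp <;> ring

/-- A feed/pump table with entries of `W`, `P` in `{0} ∪ [2/R, 1]` belongs to `E₂(R)`. [this file] -/
theorem kpNetW_inTableClass {R : ℝ} (hR : 0 < R)
    (hfeed : ∀ i₁ i₂ i₃ : Fin 4, α i₁ i₂ i₃ ((0 : ℤ), (0 : ℤ), (1 : ℤ)) = if i₁ = i₂ then W i₁ i₃ else 0)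
    (hup1 : ∀ i₁ i₂ i₃ : Fin 4, α i₁ i₂ i₃ ((1 : ℤ), (0 : ℤ), (0 : ℤ)) = if i₂ = i₃ then -(W i₂ i₁) / 2 else 0)
    (hup2 : ∀ i₁ i₂ i₃ : Fin 4, α i₁ i₂ i₃ ((0 : ℤ), (1 : ℤ), (0 : ℤ)) = if i₁ = i₃ then -(W i₁ i₂) / 2 else 0)
    (hin : ∀ i₁ i₂ i₃ : Fin 4, α i₁ i₂ i₃ ((0 : ℤ), (0 : ℤ), (0 : ℤ)) =
      (if i₁ = i₂ then P i₁ i₃ else 0) + (if i₁ = i₃ then -(P i₁ i₂) / 2 else 0) +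
        (if i₂ = i₃ then -(P i₂ i₁) / 2 else 0))
    (hW0 : ∀ a e, 0 ≤ W a e) (hW1 : ∀ a e, W a e ≤ 1) (hWR : ∀ a e, W a e = 0 ∨ 2 / R ≤ W a e)
    (hP0 : ∀ a d, 0 ≤ P a d) (hP1 : ∀ a d, P a d ≤ 1) (hPR : ∀ a d, P a d = 0 ∨ 2 / R ≤ P a d)
    (hPdiag : ∀ a, P a a = 0) :
    Literature.Analysis.FluidPDE.TaoCascade.InTableClass R α := by
  have hR1 : R⁻¹ ≤ 2 / R := by rw [div_eq_mul_inv]; nlinarith [inv_pos.2 hR]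
  -- the two shapes of non-zero entries: a weight `v` and a back-reaction `-v/2`
  have full : ∀ v : ℝ, 0 ≤ v → v ≤ 1 → (v = 0 ∨ 2 / R ≤ v) → |v| ≤ 1 ∧ (v = 0 ∨ R⁻¹ ≤ |v|) := by
    intro v h0 h1 hR'
    rw [abs_of_nonneg h0]
    exact ⟨h1, hR'.imp_right fun h => hR1.trans h⟩
  have half : ∀ v : ℝ, 0 ≤ v → v ≤ 1 → (v = 0 ∨ 2 / R ≤ v) →
      |-v / 2| ≤ 1 ∧ (-v / 2 = 0 ∨ R⁻¹ ≤ |-v / 2|) := by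
    intro v h0 h1 hR'
    have : |-v / 2| = v / 2 := by rw [neg_div, abs_neg, abs_of_nonneg (by linarith)]
    rw [this]
    refine ⟨by linarith, ?_⟩
    rcases hR' with h | h
    · left; rw [h]; ring
    · right
      calc R⁻¹ = (2 / R) / 2 := by ring
        _ ≤ v / 2 := by linarith
  have hcmp : IsComparableCoeff R α := by
    intro i₁ i₂ i₃ μ hμ
    rw [mem_shiftSet_iff] at hμ
    rcases hμ with rfl | rfl | rfl | rfl
    · -- in-shell: pumps and their back-reactions
      rw [hin]
      by_cases h12 : i₁ = i₂
      · subst h12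
        by_cases h13 : i₁ = i₃
        · subst h13
          simp [hPdiag]
        · simpa [h13] using full (P i₁ i₃) (hP0 _ _) (hP1 _ _) (hPR _ _)
      · by_cases h13 : i₁ = i₃
        · subst h13
          have h23 : ¬ i₂ = i₁ := fun h => h12 h.symm
          simpa [h12, h23] using half (P i₁ i₂) (hP0 _ _) (hP1 _ _) (hPR _ _)
        · by_cases h23 : i₂ = i₃
          · subst h23
            simpa [h12, h13] using half (P i₂ i₁) (hP0 _ _) (hP1 _ _) (hPR _ _)
          · simp [h12, h13, h23]
    · rw [hup1]
      by_cases h23 : i₂ = i₃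
      · simpa [h23] using half (W i₂ i₁) (hW0 _ _) (hW1 _ _) (hWR _ _)
      · simp [h23]
    · rw [hup2]
      by_cases h13 : i₁ = i₃
      · simpa [h13] using half (W i₁ i₂) (hW0 _ _) (hW1 _ _) (hWR _ _)
      · simp [h13]
    · rw [hfeed]
      by_cases h12 : i₁ = i₂
      · simpa [h12] using full (W i₁ i₃) (hW0 _ _) (hW1 _ _) (hWR _ _)
      · simp [h12]
  exact ⟨kpNetW_symmetric hfeed hup1 hup2 hin, kpNetW_cancelling hfeed hup1 hup2 hin, hcmp⟩

/-- The orthant (Kamke) hypothesis of the feed/pump table with `W ≥ 0`, `P ≥ 0`, via `orthant_iff_coefficients`: the feed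
forms are `Σ_a W a i·w_a²`, the cross back-reactions vanish, and the in-shell form at `y_i = 0` is `Σ_a P a i·y_a²`. [this file] -/
theorem kpNetW_orthant
    (hfeed : ∀ i₁ i₂ i₃ : Fin 4, α i₁ i₂ i₃ ((0 : ℤ), (0 : ℤ), (1 : ℤ)) = if i₁ = i₂ then W i₁ i₃ else 0)
    (hup1 : ∀ i₁ i₂ i₃ : Fin 4, α i₁ i₂ i₃ ((1 : ℤ), (0 : ℤ), (0 : ℤ)) = if i₂ = i₃ then -(W i₂ i₁) / 2 else 0)
    (hup2 : ∀ i₁ i₂ i₃ : Fin 4, α i₁ i₂ i₃ ((0 : ℤ), (1 : ℤ), (0 : ℤ)) = if i₁ = i₃ then -(W i₁ i₂) / 2 else 0)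
    (hin : ∀ i₁ i₂ i₃ : Fin 4, α i₁ i₂ i₃ ((0 : ℤ), (0 : ℤ), (0 : ℤ)) =
      (if i₁ = i₂ then P i₁ i₃ else 0) + (if i₁ = i₃ then -(P i₁ i₂) / 2 else 0) +
        (if i₂ = i₃ then -(P i₂ i₁) / 2 else 0))
    (hW0 : ∀ a e, 0 ≤ W a e) (hP0 : ∀ a d, 0 ≤ P a d) :
    ∀ (Y : Fin 4 → ℤ → ℝ → ℝ) (τ : ℝ), (∀ (j : Fin 4) (k : ℤ), 1 ≤ k → 0 ≤ Y j k τ) →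
      ∀ δ : ℝ, 0 < δ → ∀ (i : Fin 4) (n : ℤ), 1 ≤ n → Y i n τ = 0 → 0 ≤ quadTerm δ α Y i n τ := by
  rw [orthant_iff_coefficients]
  refine ⟨?_, ?_, ?_⟩
  · intro i w
    have h : ∀ i₁ : Fin 4, ∑ i₂ : Fin 4, α i₁ i₂ i (0, 0, 1) * (w i₁ * w i₂) = W i₁ i * (w i₁ * w i₁) := by
      intro i₁
      rw [Finset.sum_eq_single i₁]
      · rw [hfeed]; simp
      · intro b _ hb
        rw [hfeed]; simp [Ne.symm hb]
      · intro h; exact absurd (Finset.mem_univ _) h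
    simp only [h]
    exact Finset.sum_nonneg fun i₁ _ => mul_nonneg (hW0 _ _) (mul_self_nonneg _)
  · intro i a b hbi
    rw [hup1, hup2]
    simp [hbi]
  · intro i y hy hyi
    have h : ∀ i₁ : Fin 4, ∑ i₂ : Fin 4, α i₁ i₂ i (0, 0, 0) * (y i₁ * y i₂) =
        (if i₁ = i then 0 else P i₁ i * (y i₁ * y i₁)) := by
      intro i₁
      by_cases h1 : i₁ = i
      · subst h1
        simp [hyi]
      · rw [if_neg h1, Finset.sum_eq_single i₁]
        · rw [hin]; simp [h1]
        · intro b _ hb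
          rw [hin]
          by_cases hb' : b = i
          · subst hb'; simp [hyi]
          · simp [Ne.symm hb, h1, hb']
        · intro h; exact absurd (Finset.mem_univ _) h
    simp only [h]
    exact Finset.sum_nonneg fun i₁ _ => by
      split_ifs
      · exact le_rfl
      · exact mul_nonneg (hP0 _ _) (mul_self_nonneg _)

/-- The structural data of the feed/pump table: diagonal feeds with feed matrix `W`, pump matrix `P` (off the diagonal), no
differential triads. [this file] -/
theorem kpNetW_struct
    (hfeed : ∀ i₁ i₂ i₃ : Fin 4, α i₁ i₂ i₃ ((0 : ℤ), (0 : ℤ), (1 : ℤ)) = if i₁ = i₂ then W i₁ i₃ else 0)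
    (hin : ∀ i₁ i₂ i₃ : Fin 4, α i₁ i₂ i₃ ((0 : ℤ), (0 : ℤ), (0 : ℤ)) =
      (if i₁ = i₂ then P i₁ i₃ else 0) + (if i₁ = i₃ then -(P i₁ i₂) / 2 else 0) +
        (if i₂ = i₃ then -(P i₂ i₁) / 2 else 0)) :
    (∀ a b i : Fin 4, a ≠ b → α a b i (0, 0, 1) = 0) ∧
    (∀ a e : Fin 4, α a a e (0, 0, 1) = W a e) ∧
    (∀ a d : Fin 4, a ≠ d → α a a d (0, 0, 0) = P a d) ∧
    (∀ a b c : Fin 4, a ≠ b → a ≠ c → b ≠ c → α a b c (0, 0, 0) = 0) := by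
  refine ⟨?_, ?_, ?_, ?_⟩
  · intro a b i hab
    rw [hfeed, if_neg hab]
  · intro a e
    rw [hfeed, if_pos rfl]
  · intro a d had
    rw [hin]
    simp [had]
  · intro a b c hab hac hbc
    rw [hin]
    simp [hab, hac, hbc]

end KPNetW

/-- **EVERY NON-NEGATIVE FEED/PUMP NETWORK IS A KP NETWORK PROPER OF `E₂(R)`** (def-free realisation).  For matrices
`W, P : Fin 4 → Fin 4 → ℝ` with `W ≥ 0`, `P ≥ 0`, `P a a = 0`, all entries `≤ 1` and every non-zero entry `≥ 2/R` (`R > 0`),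
there is a table `α` with: `α ∈ E₂(R)` (symmetric, cancelling, `R`-comparable), ORTHANT, DIAGONAL feeds, feed matrix
`α a a e (0,0,1) = W a e`, pump matrix `α a a d (0,0,0) = P a d` (`a ≠ d`), and NO differential triads.  (Converse of the
normal form `Theorems.starved_coeff` / `Theorems.kpProper_quadTerm`: the triad-free KP networks proper are exactly the
non-negative feed/pump networks.)  The table is the Katz–Pavlović completion: back-reactions `−W a e/2` at
`(e,a,a),(1,0,0)` and `(a,e,a),(0,1,0)`, `−P a d/2` at `(a,d,a)` and `(d,a,a)` in shell.
[cite: Tao2016AveragedNS, §4 (4.2)–(4.3)] -/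
theorem kpNet_realization {R : ℝ} (hR : 0 < R) (W P : Fin 4 → Fin 4 → ℝ)
    (hW0 : ∀ a e, 0 ≤ W a e) (hW1 : ∀ a e, W a e ≤ 1) (hWR : ∀ a e, W a e = 0 ∨ 2 / R ≤ W a e)
    (hP0 : ∀ a d, 0 ≤ P a d) (hP1 : ∀ a d, P a d ≤ 1) (hPR : ∀ a d, P a d = 0 ∨ 2 / R ≤ P a d)
    (hPdiag : ∀ a, P a a = 0) :
    ∃ α : Fin 4 → Fin 4 → Fin 4 → ℤ × ℤ × ℤ → ℝ,
    Literature.Analysis.FluidPDE.TaoCascade.InTableClass R α ∧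
    (∀ (Y : Fin 4 → ℤ → ℝ → ℝ) (τ : ℝ), (∀ (j : Fin 4) (k : ℤ), 1 ≤ k → 0 ≤ Y j k τ) →
      ∀ δ : ℝ, 0 < δ → ∀ (i : Fin 4) (n : ℤ), 1 ≤ n → Y i n τ = 0 → 0 ≤ quadTerm δ α Y i n τ) ∧
    (∀ a b i : Fin 4, a ≠ b → α a b i (0, 0, 1) = 0) ∧
    (∀ a e : Fin 4, α a a e (0, 0, 1) = W a e) ∧
    (∀ a d : Fin 4, a ≠ d → α a a d (0, 0, 0) = P a d) ∧
    (∀ a b c : Fin 4, a ≠ b → a ≠ c → b ≠ c → α a b c (0, 0, 0) = 0) := by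
  set α : Fin 4 → Fin 4 → Fin 4 → ℤ × ℤ × ℤ → ℝ := fun i₁ i₂ i₃ μ =>
    if μ = ((0 : ℤ), (0 : ℤ), (1 : ℤ)) then (if i₁ = i₂ then W i₁ i₃ else 0)
    else if μ = ((1 : ℤ), (0 : ℤ), (0 : ℤ)) then (if i₂ = i₃ then -(W i₂ i₁) / 2 else 0)
    else if μ = ((0 : ℤ), (1 : ℤ), (0 : ℤ)) then (if i₁ = i₃ then -(W i₁ i₂) / 2 else 0)
    else if μ = ((0 : ℤ), (0 : ℤ), (0 : ℤ)) then
      ((if i₁ = i₂ then P i₁ i₃ else 0) + (if i₁ = i₃ then -(P i₁ i₂) / 2 else 0) +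
        (if i₂ = i₃ then -(P i₂ i₁) / 2 else 0))
    else 0 with hα
  have hfeed : ∀ i₁ i₂ i₃ : Fin 4, α i₁ i₂ i₃ ((0 : ℤ), (0 : ℤ), (1 : ℤ)) = if i₁ = i₂ then W i₁ i₃ else 0 := by
    intro i₁ i₂ i₃; simp [hα]
  have hup1 : ∀ i₁ i₂ i₃ : Fin 4, α i₁ i₂ i₃ ((1 : ℤ), (0 : ℤ), (0 : ℤ)) =
      if i₂ = i₃ then -(W i₂ i₁) / 2 else 0 := by
    intro i₁ i₂ i₃; simp [hα]
  have hup2 : ∀ i₁ i₂ i₃ : Fin 4, α i₁ i₂ i₃ ((0 : ℤ), (1 : ℤ), (0 : ℤ)) =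
      if i₁ = i₃ then -(W i₁ i₂) / 2 else 0 := by
    intro i₁ i₂ i₃; simp [hα]
  have hin : ∀ i₁ i₂ i₃ : Fin 4, α i₁ i₂ i₃ ((0 : ℤ), (0 : ℤ), (0 : ℤ)) =
      (if i₁ = i₂ then P i₁ i₃ else 0) + (if i₁ = i₃ then -(P i₁ i₂) / 2 else 0) +
        (if i₂ = i₃ then -(P i₂ i₁) / 2 else 0) := by
    intro i₁ i₂ i₃; simp [hα]
  obtain ⟨hdiag, hW, hP, hCz⟩ := kpNetW_struct hfeed hin
  exact ⟨α, kpNetW_inTableClass hR hfeed hup1 hup2 hin hW0 hW1 hWR hP0 hP1 hPR hPdiag,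
    kpNetW_orthant hfeed hup1 hup2 hin hW0 hP0, hdiag, hW, hP, hCz⟩

/-! ## Grading lemmas: which modes the structural clauses force to be primary -/

section Grading

variable {α : Fin 4 → Fin 4 → Fin 4 → ℤ × ℤ × ℤ → ℝ}

/-- **A mode with a self-feed is primary in every structural grading**: if `α a a a (0,0,1) ≠ 0` (the mode feeds itself one
shell up — a Katz–Pavlović strand) then clause (1) of `GradedStruct` at `a` would require `lev a < lev a`. [this file] -/
theorem kpNet_selfFeed_primary (lev : Fin 4 → ℕ)
    (hstruct : ∀ a, lev a ≠ 0 → (∃ e, α a a e (0, 0, 1) ≠ 0) →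
      (∀ j, α j j a (0, 0, 1) ≠ 0 → lev j < lev a ∧ (lev j = 0 ∨ ∃ e', α j j e' (0, 0, 1) ≠ 0)) ∧
      (∀ i₁ i₂, i₁ ≠ a → i₂ ≠ a → α i₁ i₂ a (0, 0, 0) ≠ 0 →
        (lev i₁ < lev a ∧ (lev i₁ = 0 ∨ ∃ e', α i₁ i₁ e' (0, 0, 1) ≠ 0)) ∧
        (lev i₂ < lev a ∧ (lev i₂ = 0 ∨ ∃ e', α i₂ i₂ e' (0, 0, 1) ≠ 0))) ∧
      (∃ e, α a a e (0, 0, 1) ≠ 0 ∧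
        (∀ j, α e e j (0, 0, 1) ≠ 0 → lev j < lev a ∧ (lev j = 0 ∨ ∃ e', α j j e' (0, 0, 1) ≠ 0)) ∧
        (∀ j, j ≠ e → α e e j (0, 0, 0) ≠ 0 →
          lev j < lev a ∧ (lev j = 0 ∨ ∃ e', α j j e' (0, 0, 1) ≠ 0))))
    {a : Fin 4} (ha : α a a a (0, 0, 1) ≠ 0) : lev a = 0 := by
  by_contra h
  obtain ⟨h1, _, _⟩ := hstruct a h ⟨a, ha⟩
  exact lt_irrefl _ (h1 a ha).1

/-- **Both modes of a feed 2-cycle are primary in every structural grading**: if `a` feeds `e` and `e` feeds `a`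
(`α a a e (0,0,1) ≠ 0`, `α e e a (0,0,1) ≠ 0`) and the targets of `a` are among `{e, a}`, then `lev a = 0` (apply it with the
roles exchanged for `lev e = 0`).  Clause (3) of `GradedStruct` at `a` asks for a target `e₀` of `a` all of whose own targets
lie strictly below `a`: `e₀ = e` fails because `e` targets `a` itself, and `e₀ = a` (a self-feed) fails by clause (1).
[this file] -/
theorem kpNet_twoCycle_primary (lev : Fin 4 → ℕ)
    (hstruct : ∀ a, lev a ≠ 0 → (∃ e, α a a e (0, 0, 1) ≠ 0) →
      (∀ j, α j j a (0, 0, 1) ≠ 0 → lev j < lev a ∧ (lev j = 0 ∨ ∃ e', α j j e' (0, 0, 1) ≠ 0)) ∧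
      (∀ i₁ i₂, i₁ ≠ a → i₂ ≠ a → α i₁ i₂ a (0, 0, 0) ≠ 0 →
        (lev i₁ < lev a ∧ (lev i₁ = 0 ∨ ∃ e', α i₁ i₁ e' (0, 0, 1) ≠ 0)) ∧
        (lev i₂ < lev a ∧ (lev i₂ = 0 ∨ ∃ e', α i₂ i₂ e' (0, 0, 1) ≠ 0))) ∧
      (∃ e, α a a e (0, 0, 1) ≠ 0 ∧
        (∀ j, α e e j (0, 0, 1) ≠ 0 → lev j < lev a ∧ (lev j = 0 ∨ ∃ e', α j j e' (0, 0, 1) ≠ 0)) ∧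
        (∀ j, j ≠ e → α e e j (0, 0, 0) ≠ 0 →
          lev j < lev a ∧ (lev j = 0 ∨ ∃ e', α j j e' (0, 0, 1) ≠ 0))))
    {a e : Fin 4} (hae : α a a e (0, 0, 1) ≠ 0) (hea : α e e a (0, 0, 1) ≠ 0)
    (honly : ∀ e₀, α a a e₀ (0, 0, 1) ≠ 0 → e₀ = e ∨ e₀ = a) : lev a = 0 := by
  by_contra h
  obtain ⟨h1, _, e₀, he₀, h3, _⟩ := hstruct a h ⟨e, hae⟩
  rcases honly e₀ he₀ with rfl | rfl
  · -- the target `e` feeds back into `a`: clause (3) would need `lev a < lev a`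
    exact lt_irrefl _ (h3 a hea).1
  · -- the target is `a` itself: `a` feeds `e₀ = a`, so clause (3) needs `lev e < lev a` for the target `e` of `a`… and
    -- clause (1) at `a` for its feeder `a` gives `lev a < lev a`
    exact lt_irrefl _ (h1 e₀ he₀).1

end Grading

/-- **STUB ⇒ BARRIER FOR THE FORCED PRIMARIES OF ANY FEED/PUMP NETWORK** (bookkeeping).  The body of `PrimaryGradedAt R ε₀ α`
(verbatim from the registered skeleton) for a table whose mode `a` carries a self-feed `α a a a (0,0,1) ≠ 0` yields
`θ ∈ (1/2, 1]`, `D ≥ 0` with the ν-uniform weighted shell barrier `(1+ε₀)^{2θk}·½x_{a,k}(t)² ≤ D·E₀` for mode `a` along every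
honest non-negative viscous solution from every one-shell datum.  MODEL lattice bookkeeping; no stub is proved. [this file] -/
theorem kpNet_barrier_of_primaryGraded {R ε₀ : ℝ} {α : Fin 4 → Fin 4 → Fin 4 → ℤ × ℤ × ℤ → ℝ}
    (hT : Literature.Analysis.FluidPDE.TaoCascade.InTableClass R α)
    (hO : ∀ (Y : Fin 4 → ℤ → ℝ → ℝ) (τ : ℝ), (∀ (j : Fin 4) (k : ℤ), 1 ≤ k → 0 ≤ Y j k τ) →
      ∀ δ : ℝ, 0 < δ → ∀ (i : Fin 4) (n : ℤ), 1 ≤ n → Y i n τ = 0 → 0 ≤ quadTerm δ α Y i n τ)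
    (hD : ∀ a b i : Fin 4, a ≠ b → α a b i (0, 0, 1) = 0)
    {a : Fin 4} (ha : α a a a (0, 0, 1) ≠ 0)
    (hPG : Literature.Analysis.FluidPDE.TaoCascade.InTableClass R α →
      (∀ (Y : Fin 4 → ℤ → ℝ → ℝ) (τ : ℝ), (∀ (j : Fin 4) (k : ℤ), 1 ≤ k → 0 ≤ Y j k τ) → ∀ δ : ℝ, 0 < δ →
        ∀ (i : Fin 4) (n : ℤ), 1 ≤ n → Y i n τ = 0 → 0 ≤ Literature.Analysis.FluidPDE.TaoCascade.quadTerm δ α Y i n τ) →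
      (∀ a b i : Fin 4, a ≠ b → α a b i (0, 0, 1) = 0) →
      ∃ (lev : Fin 4 → ℕ) (L : ℕ), (∀ a, lev a ≤ L) ∧
        (∀ a, lev a ≠ 0 → (∃ e, α a a e (0, 0, 1) ≠ 0) →
          (∀ j, α j j a (0, 0, 1) ≠ 0 → lev j < lev a ∧ (lev j = 0 ∨ ∃ e', α j j e' (0, 0, 1) ≠ 0)) ∧
          (∀ i₁ i₂, i₁ ≠ a → i₂ ≠ a → α i₁ i₂ a (0, 0, 0) ≠ 0 →
            (lev i₁ < lev a ∧ (lev i₁ = 0 ∨ ∃ e', α i₁ i₁ e' (0, 0, 1) ≠ 0)) ∧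
            (lev i₂ < lev a ∧ (lev i₂ = 0 ∨ ∃ e', α i₂ i₂ e' (0, 0, 1) ≠ 0))) ∧
          (∃ e, α a a e (0, 0, 1) ≠ 0 ∧
            (∀ j, α e e j (0, 0, 1) ≠ 0 → lev j < lev a ∧ (lev j = 0 ∨ ∃ e', α j j e' (0, 0, 1) ≠ 0)) ∧
            (∀ j, j ≠ e → α e e j (0, 0, 0) ≠ 0 →
              lev j < lev a ∧ (lev j = 0 ∨ ∃ e', α j j e' (0, 0, 1) ≠ 0)))) ∧
        ∃ θ : ℝ, 1 / 2 < θ ∧ θ ≤ 1 ∧ ∃ D : ℝ, 0 ≤ D ∧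
          ∀ ν : ℝ, 0 < ν → ∀ (X₀ : Fin 4 → ℝ) (s : ℝ), 0 < s → ∀ X : Fin 4 → ℤ → ℝ → ℝ,
          (∀ (i : Fin 4) (k : ℤ), X i k 0 = if k = 0 then X₀ i else 0) →
          (∀ (i : Fin 4) (k : ℤ), k < 0 → ∀ t : ℝ, X i k t = 0) →
          (∃ M : ℝ, ∀ (t : ℝ) (i : Fin 4) (k : ℤ), (1 + (1 + ε₀) ^ ((10 : ℝ) * k)) * |X i k t| ≤ M) →
          (∀ (i : Fin 4) (k : ℤ), Continuous (X i k)) →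
          (∀ (i : Fin 4) (k : ℤ), ∀ t ∈ Set.Icc (0 : ℝ) s, HasDerivWithinAt (X i k)
            (Literature.Analysis.FluidPDE.TaoCascade.quadTerm ε₀ α X i k t - ν * (1 + ε₀) ^ ((2 : ℝ) * k) * X i k t)
            (Set.Icc (0 : ℝ) s) t) →
          (∀ t ∈ Set.Icc (0 : ℝ) s, ∀ (i : Fin 4) (k : ℤ), 1 ≤ k → 0 ≤ X i k t) →
          ∀ t ∈ Set.Icc (0 : ℝ) s, ∀ i, lev i = 0 → ∀ k : ℕ,
            (1 + ε₀) ^ (2 * θ * (k : ℝ)) * ((1 / 2 : ℝ) * X i (k : ℤ) t ^ 2) ≤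
              D * (∑ j : Fin 4, (1 / 2 : ℝ) * X₀ j ^ 2)) :
    ∃ θ : ℝ, 1 / 2 < θ ∧ θ ≤ 1 ∧ ∃ D : ℝ, 0 ≤ D ∧
      ∀ ν : ℝ, 0 < ν → ∀ (X₀ : Fin 4 → ℝ) (s : ℝ), 0 < s → ∀ X : Fin 4 → ℤ → ℝ → ℝ,
      (∀ (i : Fin 4) (k : ℤ), X i k 0 = if k = 0 then X₀ i else 0) →
      (∀ (i : Fin 4) (k : ℤ), k < 0 → ∀ t : ℝ, X i k t = 0) →
      (∃ M : ℝ, ∀ (t : ℝ) (i : Fin 4) (k : ℤ), (1 + (1 + ε₀) ^ ((10 : ℝ) * k)) * |X i k t| ≤ M) →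
      (∀ (i : Fin 4) (k : ℤ), Continuous (X i k)) →
      (∀ (i : Fin 4) (k : ℤ), ∀ t ∈ Set.Icc (0 : ℝ) s, HasDerivWithinAt (X i k)
        (Literature.Analysis.FluidPDE.TaoCascade.quadTerm ε₀ α X i k t - ν * (1 + ε₀) ^ ((2 : ℝ) * k) * X i k t)
        (Set.Icc (0 : ℝ) s) t) →
      (∀ t ∈ Set.Icc (0 : ℝ) s, ∀ (i : Fin 4) (k : ℤ), 1 ≤ k → 0 ≤ X i k t) →
      ∀ t ∈ Set.Icc (0 : ℝ) s, ∀ k : ℕ,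
        (1 + ε₀) ^ (2 * θ * (k : ℝ)) * ((1 / 2 : ℝ) * X a (k : ℤ) t ^ 2) ≤
          D * (∑ i : Fin 4, (1 / 2 : ℝ) * X₀ i ^ 2) := by
  obtain ⟨lev, _L, _hL, hstruct, θ, hθ, hθ1, D, hD0, H⟩ := hPG hT hO hD
  have ha0 : lev a = 0 := kpNet_selfFeed_primary lev hstruct ha
  refine ⟨θ, hθ, hθ1, D, hD0, ?_⟩
  intro ν hν X₀ s hs X hX0 hXneg hM hXc hXd hXpos t ht k
  exact H ν hν X₀ s hs X hX0 hXneg hM hXc hXd hXpos t ht a ha0 k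

end Summit.NavierStokesRegularity.NavierStokesRegularity.Theorems

end
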